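import Summits.RiemannHypothesis.RiemannHypothesis.Theorems.TiltedLandingLaw421R3PairExactLocation

/-! # L1-far — pair-exact location of the child at TWO FLOORS (W-08 ⟨stmt 33346⟩ RUNG-P socket 3′, architecture (c); C2 desk rh-idea-2 g56; IMAGE v1)
EXTENDS L1 #1248 (`RhW08.PairExactLocation.pairExactLocationQ_18 : PairExactLocationQ 18 (9/5) 2`, the one-floor statement) by ONE binder:
`PairExactLocationFarQ lam0 a0 c₁ c₂` is `PairExactLocationQ lam0 c₁ c₂` with the extra hypothesis `a0 ≤ ‖w − p‖·‖K‖` inserted after the floor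
`lam0 ≤ min (Im w) (Im p)·‖K‖` (it does NOT restate or shadow `PairExactLocationQ`; `farQ_of_pairExactLocationQ` maps the one-floor statement into it).
WHY (director-rh (CA906)(5)/(CA908), DESIGN NOTE 5 «FLOOR-18 HOLE», C2 memo `pub/ideators/rh-idea-2/g56/doc/PRICE-T1-Gdirection-C2-g56.md`): at the
z-end of a far pair the floor `Im v·‖K_z‖` drops to ≥ 8.07 at the top of the G-box on 33/291 rows of the (c) cell table while the pair distance stays
`‖z − v‖·‖K_z‖ ≥ 14.1`; the pair of floors `(8, 14)` replaces the single floor `18` there.  PROVES `pairExactLocationFarQ_8_14 : PairExactLocationFarQ 8 14 (9/5) 4`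
(c₁ = 9/5 of record, c₂ = 4), the booked name `pairExactLocationFarTarget_8_14_6 : … (9/5) 6`, the by-name surface `pairExactLocationFarQ_of_le`, and the
floor-18 calibration `pairExactLocationFarQ_18 : PairExactLocationFarQ 18 a0 (9/5) 2` (from #1248) — ONE statement shape for both ends of the table.
A pure inequality over `ℂ`: no `f`, no holomorphy, no Rouché, no count.  SUPPORT (K only; asserts no law); RH is not proved and nothing here bears on it;
⟨33346⟩/⟨33347⟩ OPEN.
PROOF = #1248's, with §1 (the dimensionless kernel) RE-RUN at the floors `(L, a, b) ≥ (8, 14, L + 8)`: `qh ≤ 1/77`; a FIVE-round linear bootstrap of the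
a-priori radius `t ≤ 3 → 21/10 → 11/7 → 137/100 → 131/100 → 13/10` (fixed point ≈ 1.278 at the corner `(8, 14, 16, M = 10)`); the term bounds at
`t ≤ 13/10` (`(1/3)/L`, `(5/2)L²/a³`, `(5/2)/L`, `(169/100)M`, `L²qh² ≤ (9/50)/L + (21/100)L²/a³`, TERM3 `≤ 1/L + (6/5)L²/a³ + (13/200)M`) and the kernel
`≤ (9/5)M + 4/L + 4L²/a³` (totals `1.755M + 3.84/L + 3.7L²/a³`).  §2 of #1248 (Taylor remainders, `K + X = −d⁻¹`, the key identity, the norm facts) is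
CITED BY NAME through the one import; §4 (`kernel_raw_far`, the main theorem) is #1248's §4 text with the floor lines swapped (`8 ≤ Im w·κ`, `8 ≤ Im p·κ`
from the pair floor; `14 ≤ ‖w − p‖κ` is the new binder; `‖d‖ < ‖w − p‖` now from `‖d‖κ ≤ 3 < 14`).  `prod_le3` stays a local `have` (v3 lesson, (CA888)). -/

namespace RhW08.PairExactLocationFar

open Complex
open scoped ComplexConjugate
open RhW08.PairExactLocation (PairExactLocationQ qh Th Xh qh_nonneg piece_le ne_zero_of_norm_lt norm_rem_le norm_key_le K_add_X norm_sub_conj_eq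
  im_add_im_le_norm_sub_conj norm_sub_le_norm_sub_conj)

/-! ## §0  The two-floor statement -/
/-- «L1-far»: `PairExactLocationQ` with the floor split into a pair floor `lam0 ≤ min(Im w, Im p)·‖K‖` and a distance floor `a0 ≤ ‖w − p‖·‖K‖`
(one extra binder, inserted after the `lam0` binder; everything else verbatim #1248 / WANTED v3 block 8ef3a83acd685716). -/
def PairExactLocationFarQ (lam0 a0 c₁ c₂ : ℝ) : Prop :=
  ∀ (u w p R K Q : ℂ) (M : ℝ), 0 < w.im → 0 < p.im → min w.im p.im ≤ 2 * ‖w - p‖ →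
    K = (w - conj w)⁻¹ + (w - p)⁻¹ + (w - conj p)⁻¹ + R → Q = -((w - conj w)⁻¹ ^ 2 + (w - p)⁻¹ ^ 2 + (w - conj p)⁻¹ ^ 2) →
    lam0 ≤ min w.im p.im * ‖K‖ → a0 ≤ ‖w - p‖ * ‖K‖ → 0 ≤ M → M ≤ 10 → u ≠ w → ‖u - w‖ ≤ 3 / ‖K‖ →
    ‖(u - w)⁻¹ + (u - conj w)⁻¹ + (u - p)⁻¹ + (u - conj p)⁻¹ + R‖ ≤ M * ‖u - w‖ / w.im ^ 2 →
    ‖u - (w - K⁻¹ - Q * K⁻¹ ^ 3)‖ ≤ (c₁ * M + c₂ * ((1 + (w.im / ‖w - p‖) ^ 3) / (w.im * ‖K‖))) / (w.im * ‖K‖) ^ 2 / ‖K‖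

/-- the one-floor L1 gives the two-floor one at the same `lam0` for ANY `a0` (the extra binder is simply dropped). -/
theorem farQ_of_pairExactLocationQ {lam0 c₁ c₂ : ℝ} (a0 : ℝ) (h : PairExactLocationQ lam0 c₁ c₂) : PairExactLocationFarQ lam0 a0 c₁ c₂ :=
  fun u w p R K Q M hw hp hsep hK hQ hfl _ hM0 hM10 hu hdisc himp => h u w p R K Q M hw hp hsep hK hQ hfl hM0 hM10 hu hdisc himp

/-- monotone in both floors and both constants. -/
theorem farQ_mono {lam0 lam0' a0 a0' c₁ c₁' c₂ c₂' : ℝ} (h0 : lam0 ≤ lam0') (ha : a0 ≤ a0') (h1 : c₁ ≤ c₁') (h2 : c₂ ≤ c₂')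
    (hP : PairExactLocationFarQ lam0 a0 c₁ c₂) : PairExactLocationFarQ lam0' a0' c₁' c₂' := by
  intro u w p R K Q M hw hp hsep hK hQ hfl hfa hM0 hM10 hu hdisc himp
  have hρ : 0 ≤ (1 + (w.im / ‖w - p‖) ^ 3) / (w.im * ‖K‖) := by positivity
  refine (hP u w p R K Q M hw hp hsep hK hQ (h0.trans hfl) (ha.trans hfa) hM0 hM10 hu hdisc himp).trans ?_
  gcongr

/-! ## §1-far  The dimensionless kernel at floors `L ≥ 8`, `a ≥ 14`, `b ≥ 16` (`b ≥ L + 8`, `b ≥ a`) -/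
/-- `qh ≤ 1/77` (`1/256 + 1/196 + 1/256 = 81/6272`). -/
theorem qh_le_far {L a b : ℝ} (hL : 8 ≤ L) (ha : 14 ≤ a) (hb : 16 ≤ b) : qh L a b ≤ 1 / 77 := by
  have h1 : 1 / (4 * L ^ 2) ≤ 1 / 256 := one_div_le_one_div_of_le (by norm_num) (by nlinarith)
  have h2 : 1 / a ^ 2 ≤ 1 / 196 := one_div_le_one_div_of_le (by norm_num) (by nlinarith)
  have h3 : 1 / b ^ 2 ≤ 1 / 256 := one_div_le_one_div_of_le (by norm_num) (by nlinarith)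
  unfold qh; linarith
/-- `0 ≤ Th` for `t < 14`. -/
theorem Th_nonneg_far {L a b t : ℝ} (hL : 8 ≤ L) (ha : 14 ≤ a) (hb : 16 ≤ b) (ht : t < 14) : 0 ≤ Th L a b t := by
  obtain ⟨h1, h2, h3⟩ : 0 ≤ 2 * L - t ∧ 0 ≤ a - t ∧ 0 ≤ b - t := ⟨by linarith, by linarith, by linarith⟩
  unfold Th
  exact add_nonneg (add_nonneg (div_nonneg (sq_nonneg t) (mul_nonneg (by positivity) h1))
    (div_nonneg (sq_nonneg t) (mul_nonneg (sq_nonneg a) h2))) (div_nonneg (sq_nonneg t) (mul_nonneg (sq_nonneg b) h3))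
/-- `Th` at `t ≤ t₀ < 14` under the far floors (pieces via #1248 `piece_le`). -/
theorem Th_le_far {L a b t t₀ : ℝ} (hL : 8 ≤ L) (ha : 14 ≤ a) (hb : 16 ≤ b) (ht0 : 0 ≤ t) (ht : t ≤ t₀) (ht₀ : t₀ < 14) :
    Th L a b t ≤ t₀ ^ 2 / (256 * (16 - t₀)) + t₀ ^ 2 / (196 * (14 - t₀)) + t₀ ^ 2 / (256 * (16 - t₀)) := by
  have h1 := piece_le (c := 4 * L ^ 2) (e := 2 * L) (c₀ := 256) (e₀ := 16) (by nlinarith) (by norm_num) (by linarith) ht0 ht (by linarith)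
  have h2 := piece_le (c := a ^ 2) (e := a) (c₀ := 196) (e₀ := 14) (by nlinarith) (by norm_num) ha ht0 ht ht₀
  have h3 := piece_le (c := b ^ 2) (e := b) (c₀ := 256) (e₀ := 16) (by nlinarith) (by norm_num) hb ht0 ht (by linarith)
  unfold Th; linarith
/-- `Th ≤ (7/50)·qh` for `t ≤ 13/10` (`(13/10)²/(14 − 13/10) = 0.1331 ≤ 7/50`). -/
theorem Th_le_qh_far {L a b t : ℝ} (hL : 8 ≤ L) (ha : 14 ≤ a) (hb : 16 ≤ b) (ht0 : 0 ≤ t) (ht : t ≤ 13 / 10) :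
    Th L a b t ≤ 7 / 50 * qh L a b := by
  have g : ∀ {c e : ℝ}, 0 < c → 14 ≤ e → t ^ 2 / (c * (e - t)) ≤ 7 / 50 * (1 / c) := fun {c e} hc he => by
    rw [show 7 / 50 * (1 / c) = 7 / 50 / c by ring, div_le_div_iff₀ (mul_pos hc (by linarith)) hc]
    nlinarith [mul_le_mul_of_nonneg_left (show t ^ 2 ≤ 7 / 50 * (e - t) by nlinarith) hc.le]
  have h1 := g (c := 4 * L ^ 2) (e := 2 * L) (by positivity) (by linarith)
  have h2 := g (c := a ^ 2) (e := a) (by positivity) ha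
  have h3 := g (c := b ^ 2) (e := b) (by positivity) (by linarith)
  unfold Th qh; linarith
/-- `0 ≤ Xh` for `0 ≤ t < 14`, `0 ≤ M`. -/
theorem Xh_nonneg_far {L a b t M : ℝ} (hL : 8 ≤ L) (ha : 14 ≤ a) (hb : 16 ≤ b) (hM0 : 0 ≤ M) (ht0 : 0 ≤ t) (ht : t < 14) :
    0 ≤ Xh L a b t M := by
  have h1 := Th_nonneg_far hL ha hb ht; have h2 := qh_nonneg L a b; unfold Xh; positivity
/-- `Xh` at `t ≤ t₀ < 14`. -/
theorem Xh_le_far {L a b t M t₀ : ℝ} (hL : 8 ≤ L) (ha : 14 ≤ a) (hb : 16 ≤ b) (hM : M ≤ 10) (ht0 : 0 ≤ t) (ht : t ≤ t₀) (ht₀ : t₀ < 14) :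
    Xh L a b t M ≤ t₀ / 77 + (t₀ ^ 2 / (256 * (16 - t₀)) + t₀ ^ 2 / (196 * (14 - t₀)) + t₀ ^ 2 / (256 * (16 - t₀))) + 10 * t₀ / 64 := by
  have h1 : qh L a b * t ≤ 1 / 77 * t₀ := mul_le_mul (qh_le_far hL ha hb) ht ht0 (by norm_num)
  have h2 := Th_le_far hL ha hb ht0 ht ht₀
  have h3 : M * t / L ^ 2 ≤ 10 * t₀ / 64 := by
    rw [div_le_div_iff₀ (by positivity) (by norm_num)]
    exact mul_le_mul (mul_le_mul hM ht ht0 (by norm_num)) (by nlinarith) (by norm_num) (by linarith)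
  unfold Xh; linarith
/-- FIVE-round linear BOOTSTRAP of the a-priori radius: `t ≤ 3` and `t ≤ 1 + t·Xh(t)` give `t ≤ 13/10`
(`3 → 21/10 → 11/7 → 137/100 → 131/100 → 13/10`; the fixed point is ≈ 1.278 at the corner `(8, 14, 16, M = 10)`). -/
theorem boot_far {L a b t M : ℝ} (hL : 8 ≤ L) (ha : 14 ≤ a) (hb : 16 ≤ b) (hM : M ≤ 10) (ht0 : 0 ≤ t) (ht3 : t ≤ 3)
    (hboot : t ≤ 1 + t * Xh L a b t M) : t ≤ 13 / 10 := by
  have hX1 : Xh L a b t M ≤ 518 / 1000 := (Xh_le_far hL ha hb hM ht0 ht3 (by norm_num)).trans (by norm_num)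
  have ht1 : t ≤ 21 / 10 := by nlinarith [mul_le_mul_of_nonneg_left hX1 ht0]
  have hX2 : Xh L a b t M ≤ 36 / 100 := (Xh_le_far hL ha hb hM ht0 ht1 (by norm_num)).trans (by norm_num)
  have ht2 : t ≤ 11 / 7 := by nlinarith [mul_le_mul_of_nonneg_left hX2 ht0]
  have hX3 : Xh L a b t M ≤ 2683 / 10000 := (Xh_le_far hL ha hb hM ht0 ht2 (by norm_num)).trans (by norm_num)
  have ht3' : t ≤ 137 / 100 := by nlinarith [mul_le_mul_of_nonneg_left hX3 ht0]
  have hX4 : Xh L a b t M ≤ 2337 / 10000 := (Xh_le_far hL ha hb hM ht0 ht3' (by norm_num)).trans (by norm_num)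
  have ht4 : t ≤ 131 / 100 := by nlinarith [mul_le_mul_of_nonneg_left hX4 ht0]
  have hX5 : Xh L a b t M ≤ 2234 / 10000 := (Xh_le_far hL ha hb hM ht0 ht4 (by norm_num)).trans (by norm_num)
  nlinarith [mul_le_mul_of_nonneg_left hX5 ht0]
/-- TERM1, pole `w̄`: `L²·t·t²/(4L²(2L − t)) ≤ (1/3)/L` at `t ≤ 13/10`, `L ≥ 8`. -/
theorem term1w_far {L t : ℝ} (hL : 8 ≤ L) (ht0 : 0 < t) (ht : t ≤ 13 / 10) :
    L ^ 2 * t * (t ^ 2 / (4 * L ^ 2 * (2 * L - t))) ≤ 1 / 3 * (1 / L) := by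
  obtain ⟨h2L, hL0, ht3⟩ : 0 < 2 * L - t ∧ 0 < L ∧ t ^ 3 ≤ (13 / 10) ^ 3 := ⟨by linarith, by linarith, pow_le_pow_left₀ ht0.le ht 3⟩
  rw [show (1:ℝ) / 3 * (1 / L) = 1 / 3 / L by ring, ← mul_div_assoc, div_le_div_iff₀ (by positivity) hL0]
  have key : L * t ^ 3 ≤ 1 / 3 * (4 * (2 * L - t)) := by nlinarith [mul_le_mul_of_nonneg_left ht3 hL0.le]
  nlinarith [mul_le_mul_of_nonneg_left key (sq_nonneg L)]
/-- TERM1, pole `p`: `L²·t·t²/(a²(a − t)) ≤ (5/2)·L²/a³` at `t ≤ 13/10`, `a ≥ 14`. -/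
theorem term1a_far {L a t : ℝ} (ha : 14 ≤ a) (hL0 : 0 < L) (ht0 : 0 < t) (ht : t ≤ 13 / 10) :
    L ^ 2 * t * (t ^ 2 / (a ^ 2 * (a - t))) ≤ 5 / 2 * (L ^ 2 / a ^ 3) := by
  obtain ⟨hat, ha0, ht3⟩ : 0 < a - t ∧ 0 < a ∧ t ^ 3 ≤ (13 / 10) ^ 3 := ⟨by linarith, by linarith, pow_le_pow_left₀ ht0.le ht 3⟩
  have ht3' : t ^ 3 ≤ 5 / 2 := ht3.trans (by norm_num)
  rw [← mul_div_assoc, ← mul_div_assoc, div_le_div_iff₀ (by positivity) (by positivity)]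
  have key : t ^ 3 * a ≤ 5 / 2 * (a - t) := by nlinarith [mul_nonneg (sub_nonneg.2 ha) (sub_nonneg.2 ht3')]
  nlinarith [mul_le_mul_of_nonneg_left key (by positivity : (0:ℝ) ≤ L ^ 2 * a ^ 2)]
/-- TERM1, pole `p̄`: `L²·t·t²/(b²(b − t)) ≤ (5/2)/L` at `t ≤ 13/10` (uses `b ≥ L`, `b ≥ 16`). -/
theorem term1b_far {L b t : ℝ} (hL : 8 ≤ L) (hb : 16 ≤ b) (hbL : L ≤ b) (ht0 : 0 < t) (ht : t ≤ 13 / 10) :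
    L ^ 2 * t * (t ^ 2 / (b ^ 2 * (b - t))) ≤ 5 / 2 * (1 / L) := by
  obtain ⟨hbt, hL0, hb0, ht3⟩ : 0 < b - t ∧ 0 < L ∧ 0 < b ∧ t ^ 3 ≤ (13 / 10) ^ 3 := ⟨by linarith, by linarith, by linarith, pow_le_pow_left₀ ht0.le ht 3⟩
  rw [show (5:ℝ) / 2 * (1 / L) = 5 / 2 / L by ring, ← mul_div_assoc, div_le_div_iff₀ (by positivity) hL0]
  have h1 : L ^ 3 ≤ b ^ 3 := pow_le_pow_left₀ hL0.le hbL 3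
  have h2 : t * b ^ 2 ≤ 13 / 10 / 16 * b ^ 3 := by nlinarith [mul_nonneg (sq_nonneg b) (show (0:ℝ) ≤ 13 / 10 / 16 * b - t by linarith)]
  nlinarith [mul_le_mul_of_nonneg_left ht3 (pow_nonneg hL0.le 3), mul_le_mul_of_nonneg_left h1 (by norm_num : (0:ℝ) ≤ (13 / 10) ^ 3),
    pow_nonneg hb0.le 3]
/-- TERM2: `L²·t·(M t/L²) = M t² ≤ (169/100)·M`. -/
theorem term2_far {L t M : ℝ} (hL0 : 0 < L) (hM0 : 0 ≤ M) (ht0 : 0 < t) (ht : t ≤ 13 / 10) : L ^ 2 * t * (M * t / L ^ 2) ≤ 169 / 100 * M := by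
  have ht2 : t ^ 2 ≤ (13 / 10) ^ 2 := pow_le_pow_left₀ ht0.le ht 2
  rw [show L ^ 2 * t * (M * t / L ^ 2) = M * t ^ 2 by field_simp]
  nlinarith [mul_le_mul_of_nonneg_left ht2 hM0]
/-- `L²·qh² ≤ (9/50)/L + (21/100)·L²/a³` at the far floors (six expanded terms; `16a ≤ b²` from `b ≥ 16`, `b ≥ a`; the case split `2a ≤ L ∨ L ≤ 2a`). -/
theorem Lq2_le_far {L a b : ℝ} (hL : 8 ≤ L) (ha : 14 ≤ a) (hab : a ≤ b) (hb : 16 ≤ b) (hbL : L ≤ b) :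
    L ^ 2 * qh L a b ^ 2 ≤ 9 / 50 * (1 / L) + 21 / 100 * (L ^ 2 / a ^ 3) := by
  obtain ⟨hL0, ha0, hb0⟩ : 0 < L ∧ 0 < a ∧ 0 < b := ⟨by linarith, by linarith, by linarith⟩
  have e : L ^ 2 * qh L a b ^ 2 = 1 / (16 * L ^ 2) + L ^ 2 / a ^ 4 + L ^ 2 / b ^ 4 + 1 / (2 * a ^ 2) + 1 / (2 * b ^ 2) + 2 * L ^ 2 / (a ^ 2 * b ^ 2) := by
    unfold qh; field_simp; ring
  have h1 : 1 / (16 * L ^ 2) ≤ 1 / 128 * (1 / L) := by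
    rw [show (1:ℝ) / 128 * (1 / L) = 1 / 128 / L by ring, div_le_div_iff₀ (by positivity) hL0]; nlinarith
  have h2 : L ^ 2 / a ^ 4 ≤ 1 / 14 * (L ^ 2 / a ^ 3) := by
    rw [← mul_div_assoc, div_le_div_iff₀ (by positivity) (by positivity)]
    nlinarith [mul_nonneg (mul_nonneg (sq_nonneg L) (pow_nonneg ha0.le 3)) (sub_nonneg.2 ha)]
  have h3 : L ^ 2 / b ^ 4 ≤ 1 / 16 * (1 / L) := by
    rw [show (1:ℝ) / 16 * (1 / L) = 1 / 16 / L by ring, div_le_div_iff₀ (by positivity) hL0]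
    have i1 : L ^ 3 ≤ b ^ 3 := pow_le_pow_left₀ hL0.le hbL 3
    nlinarith [mul_le_mul hb i1 (pow_nonneg hL0.le 3) hb0.le]
  have h4 : 1 / (2 * a ^ 2) ≤ 1 / 112 * (L ^ 2 / a ^ 3) + 1 / 14 * (1 / L) := by
    obtain ⟨hA0, hB0⟩ : 0 ≤ 1 / 112 * (L ^ 2 / a ^ 3) ∧ 0 ≤ 1 / 14 * (1 / L) := ⟨by positivity, by positivity⟩
    rcases le_total (2 * a) L with hc | hc
    · have : 1 / (2 * a ^ 2) ≤ 1 / 112 * (L ^ 2 / a ^ 3) := by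
        rw [← mul_div_assoc, div_le_div_iff₀ (by positivity) (by positivity)]
        have i1 : 4 * a ^ 2 ≤ L ^ 2 := by nlinarith [mul_le_mul hc hc (by positivity) hL0.le]
        have i2 : (0:ℝ) ≤ L ^ 2 - 56 * a := by nlinarith [mul_nonneg ha0.le (sub_nonneg.2 ha)]
        nlinarith [mul_nonneg (sq_nonneg a) i2]
      linarith
    · have : 1 / (2 * a ^ 2) ≤ 1 / 14 * (1 / L) := by
        rw [show (1:ℝ) / 14 * (1 / L) = 1 / 14 / L by ring, div_le_div_iff₀ (by positivity) hL0]
        nlinarith [mul_nonneg ha0.le (sub_nonneg.2 ha)]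
      linarith
  have h5 : 1 / (2 * b ^ 2) ≤ 1 / 32 * (1 / L) := by
    rw [show (1:ℝ) / 32 * (1 / L) = 1 / 32 / L by ring, div_le_div_iff₀ (by positivity) hL0]; nlinarith [mul_nonneg hb0.le (sub_nonneg.2 hb)]
  have h6 : 2 * L ^ 2 / (a ^ 2 * b ^ 2) ≤ 1 / 8 * (L ^ 2 / a ^ 3) := by
    rw [← mul_div_assoc, div_le_div_iff₀ (by positivity) (by positivity)]
    have i1 : (0:ℝ) ≤ b ^ 2 - 16 * a := by nlinarith [mul_nonneg hb0.le (sub_nonneg.2 hb)]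
    nlinarith [mul_nonneg (mul_nonneg (sq_nonneg L) (sq_nonneg a)) i1]
  obtain ⟨hA0, hL1⟩ : 0 ≤ L ^ 2 / a ^ 3 ∧ 0 ≤ 1 / L := ⟨by positivity, by positivity⟩
  rw [e]; linarith
/-- TERM3: `L²·qh·Xh·(2 + Xh)·t² ≤ 1/L + (6/5)·L²/a³ + (13/200)·M` (via `L²Xh ≤ (36/25)L²qh + (13/10)M`, `Xh ≤ 89/400`, `Lq2_le_far`). -/
theorem term3_far {L a b t M : ℝ} (hL : 8 ≤ L) (ha : 14 ≤ a) (hab : a ≤ b) (hb : 16 ≤ b) (hbL : L ≤ b) (hM0 : 0 ≤ M) (hM : M ≤ 10)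
    (ht0 : 0 < t) (ht : t ≤ 13 / 10) :
    L ^ 2 * qh L a b * Xh L a b t M * (2 + Xh L a b t M) * t ^ 2 ≤ 1 * (1 / L) + 6 / 5 * (L ^ 2 / a ^ 3) + 13 / 200 * M := by
  have prod_le3 {x y z x' y' z' : ℝ} (hx : 0 ≤ x) (hy : 0 ≤ y) (hz : 0 ≤ z) (hxx : x ≤ x') (hyy : y ≤ y') (hzz : z ≤ z') :
      x * y * z ≤ x' * y' * z' := mul_le_mul (mul_le_mul hxx hyy hy (hx.trans hxx)) hzz hz (mul_nonneg (hx.trans hxx) (hy.trans hyy))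
  have hq0 := qh_nonneg L a b; have hq := qh_le_far hL ha hb; have hTh := Th_le_qh_far hL ha hb ht0.le ht
  obtain ⟨hL0, hX0⟩ : 0 < L ∧ 0 ≤ Xh L a b t M := ⟨by linarith, Xh_nonneg_far hL ha hb hM0 ht0.le (by linarith)⟩
  have ht2 : t ^ 2 ≤ (13 / 10) ^ 2 := pow_le_pow_left₀ ht0.le ht 2
  have eM : L ^ 2 * (M * t / L ^ 2) = M * t := by field_simp
  have hLX : L ^ 2 * Xh L a b t M ≤ 36 / 25 * (L ^ 2 * qh L a b) + 13 / 10 * M := by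
    have i1 : L ^ 2 * (qh L a b * t) ≤ L ^ 2 * (qh L a b * (13 / 10)) := mul_le_mul_of_nonneg_left (mul_le_mul_of_nonneg_left ht hq0) (sq_nonneg L)
    have i2 : L ^ 2 * Th L a b t ≤ L ^ 2 * (7 / 50 * qh L a b) := mul_le_mul_of_nonneg_left hTh (sq_nonneg L)
    have i3 : M * t ≤ M * (13 / 10) := mul_le_mul_of_nonneg_left ht hM0
    unfold Xh; rw [mul_add, mul_add, eM]; nlinarith
  have hX : Xh L a b t M ≤ 89 / 400 := by
    have i1 : qh L a b * t ≤ 1 / 77 * (13 / 10) := mul_le_mul hq ht ht0.le (by norm_num)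
    have i3 : M * t / L ^ 2 ≤ 10 * (13 / 10) / 64 := by
      rw [div_le_div_iff₀ (by positivity) (by norm_num)]
      exact mul_le_mul (mul_le_mul hM ht ht0.le (by norm_num)) (by nlinarith) (by norm_num) (by positivity)
    have i2 : Th L a b t ≤ 7 / 50 * (1 / 77) := hTh.trans (by nlinarith)
    unfold Xh; nlinarith
  rw [show L ^ 2 * qh L a b * Xh L a b t M * (2 + Xh L a b t M) * t ^ 2 = (L ^ 2 * Xh L a b t M) * qh L a b * (2 + Xh L a b t M) * t ^ 2 by ring]
  refine (prod_le3 (mul_nonneg (mul_nonneg (sq_nonneg L) hX0) hq0) (by linarith) (sq_nonneg t) (mul_le_mul_of_nonneg_right hLX hq0)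
    (show 2 + Xh L a b t M ≤ 889 / 400 by linarith) ht2).trans ?_
  have hLq := Lq2_le_far hL ha hab hb hbL
  have hqM : M * qh L a b ≤ M * (1 / 77) := mul_le_mul_of_nonneg_left hq hM0
  obtain ⟨hA0, hL1⟩ : 0 ≤ L ^ 2 / a ^ 3 ∧ 0 ≤ 1 / L := ⟨by positivity, by positivity⟩
  linarith [mul_nonneg hM0 hq0]
/-- THE FAR KERNEL: with the bootstrap radius `t ≤ 13/10`, the scaled error is within budget `(9/5)M + 4/L + 4L²/a³`. -/
theorem kernel_far {L a b t M : ℝ} (hL : 8 ≤ L) (ha : 14 ≤ a) (hab : a ≤ b) (hbL : L + 8 ≤ b) (hM0 : 0 ≤ M) (hM : M ≤ 10)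
    (ht0 : 0 < t) (ht : t ≤ 13 / 10) :
    L ^ 2 * (t * (Th L a b t + M * t / L ^ 2) + qh L a b * Xh L a b t M * (2 + Xh L a b t M) * t ^ 2) ≤ 9 / 5 * M + 4 / L + 4 * L ^ 2 / a ^ 3 := by
  obtain ⟨hb, hbL', hL0⟩ : 16 ≤ b ∧ L ≤ b ∧ 0 < L := ⟨by linarith, by linarith, by linarith⟩
  rw [show L ^ 2 * (t * (Th L a b t + M * t / L ^ 2) + qh L a b * Xh L a b t M * (2 + Xh L a b t M) * t ^ 2)
      = L ^ 2 * t * (t ^ 2 / (4 * L ^ 2 * (2 * L - t))) + L ^ 2 * t * (t ^ 2 / (a ^ 2 * (a - t))) + L ^ 2 * t * (t ^ 2 / (b ^ 2 * (b - t)))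
        + L ^ 2 * t * (M * t / L ^ 2) + L ^ 2 * qh L a b * Xh L a b t M * (2 + Xh L a b t M) * t ^ 2 by unfold Th; ring,
    show 4 * L ^ 2 / a ^ 3 = 4 * (L ^ 2 / a ^ 3) by ring, show (4:ℝ) / L = 4 * (1 / L) by ring]
  have h1 := term1w_far hL ht0 ht
  have h2 := term1a_far ha hL0 ht0 ht
  have h3 := term1b_far hL hb hbL' ht0 ht
  have h4 := term2_far hL0 hM0 ht0 ht
  have h5 := term3_far hL ha hab hb hbL' hM0 hM ht0 ht
  obtain ⟨hA0, hL1⟩ : 0 ≤ L ^ 2 / a ^ 3 ∧ 0 ≤ 1 / L := ⟨by positivity, by positivity⟩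
  linarith

/-! ## §4-far  From norms to the kernel, and the two-floor location lemma (#1248 §4 text with the floor lines swapped; §2 cited by name) -/
/-- RAW KERNEL (far floors): as #1248 `kernel_raw` with `(18, 9, L + 18)` replaced by `(8, 14, L + 8)`, `boot` by `boot_far`, budget `4`. -/
theorem kernel_raw_far {κ h r n M L a b t nT nE nQ nX nXQ err : ℝ} (hκ : 0 < κ) (hh : 0 < h) (hr : 0 < r) (hn : 0 < n)
    (hLe : L = h * κ) (hae : a = r * κ) (hte : t = n * κ) (hL : 8 ≤ L) (ha : 14 ≤ a) (hab : a ≤ b) (hbL : L + 8 ≤ b)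
    (hM0 : 0 ≤ M) (hM : M ≤ 10) (ht3 : t ≤ 3) (hT : nT ≤ κ * Th L a b t) (hE : nE ≤ κ * (M * t / L ^ 2)) (hQ : nQ ≤ κ ^ 2 * qh L a b)
    (hX : nX ≤ nQ * n + nT + nE) (hXQ : nXQ ≤ nT + nE) (hnQ : 0 ≤ nQ) (hnX : 0 ≤ nX) (hboot : κ ≤ n⁻¹ + nX)
    (herr : err ≤ nXQ * n / κ + nQ * nX * (2 * κ + nX) * n ^ 2 / κ ^ 3) :
    err ≤ (9 / 5 * M + 4 * ((1 + (h / r) ^ 3) / (h * κ))) / (h * κ) ^ 2 / κ := by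
  have prod_le3 {x y z x' y' z' : ℝ} (hx : 0 ≤ x) (hy : 0 ≤ y) (hz : 0 ≤ z) (hxx : x ≤ x') (hyy : y ≤ y') (hzz : z ≤ z') :
      x * y * z ≤ x' * y' * z' := mul_le_mul (mul_le_mul hxx hyy hy (hx.trans hxx)) hzz hz (mul_nonneg (hx.trans hxx) (hy.trans hyy))
  obtain ⟨hL0, hb16, ht0, hq0⟩ : 0 < L ∧ 16 ≤ b ∧ 0 < t ∧ 0 ≤ qh L a b := ⟨by linarith, by linarith, by rw [hte]; exact mul_pos hn hκ, qh_nonneg L a b⟩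
  have hXh : nX ≤ κ * Xh L a b t M := by
    have h1 := mul_le_mul_of_nonneg_right hQ hn.le
    unfold Xh; rw [mul_add, mul_add, ← show κ ^ 2 * qh L a b * n = κ * (qh L a b * t) by rw [hte]; ring]; linarith
  have hboot' : t ≤ 1 + t * Xh L a b t M := by
    have h2 := mul_le_mul_of_nonneg_left hboot hn.le
    rw [mul_add, mul_inv_cancel₀ hn.ne'] at h2
    have e1 : n * (κ * Xh L a b t M) = t * Xh L a b t M := by rw [hte]; ring
    linarith [mul_le_mul_of_nonneg_left hXh hn.le]
  have ht13 := boot_far hL ha hb16 hM ht0.le ht3 hboot'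
  have hXh0 := Xh_nonneg_far hL ha hb16 hM0 ht0.le (by linarith)
  have hTE : nXQ ≤ κ * (Th L a b t + M * t / L ^ 2) := by rw [mul_add]; linarith
  have hB : err ≤ (κ * (Th L a b t + M * t / L ^ 2)) * n / κ + (κ ^ 2 * qh L a b) * (κ * Xh L a b t M) * (2 * κ + κ * Xh L a b t M) * n ^ 2 / κ ^ 3 :=
    herr.trans (add_le_add (div_le_div_of_nonneg_right (mul_le_mul_of_nonneg_right hTE hn.le) hκ.le) (div_le_div_of_nonneg_right
      (mul_le_mul_of_nonneg_right (prod_le3 hnQ hnX (by positivity) hQ hXh (by linarith)) (sq_nonneg n)) (pow_nonneg hκ.le 3)))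
  have hκ0 := hκ.ne'; have hL0' := hL0.ne'; have hh0 := hh.ne'; have hr0 := hr.ne'
  have eB : (κ * (Th L a b t + M * t / L ^ 2)) * n / κ + (κ ^ 2 * qh L a b) * (κ * Xh L a b t M) * (2 * κ + κ * Xh L a b t M) * n ^ 2 / κ ^ 3
      = L ^ 2 * (t * (Th L a b t + M * t / L ^ 2) + qh L a b * Xh L a b t M * (2 + Xh L a b t M) * t ^ 2) / (L ^ 2 * κ) := by
    rw [hte]; field_simp
  have ebud : (9 / 5 * M + 4 / L + 4 * L ^ 2 / a ^ 3) / (L ^ 2 * κ) = (9 / 5 * M + 4 * ((1 + (h / r) ^ 3) / (h * κ))) / (h * κ) ^ 2 / κ := by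
    rw [hLe, hae]; field_simp; ring
  calc err ≤ _ := hB
    _ = _ := eB
    _ ≤ (9 / 5 * M + 4 / L + 4 * L ^ 2 / a ^ 3) / (L ^ 2 * κ) := div_le_div_of_nonneg_right (kernel_far hL ha hab hbL hM0 hM ht0 ht13) (by positivity)
    _ = _ := ebud
/-- **L1-far**: `PairExactLocationFarQ 8 14 (9/5) 4` — #1248's main proof with the floor lines swapped
(`8 ≤ Im w·κ`, `8 ≤ Im p·κ` from the pair floor; `14 ≤ ‖w − p‖κ` is the new binder; `‖d‖ < ‖w − p‖` now from `‖d‖κ ≤ 3 < 14`). -/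
theorem pairExactLocationFarQ_8_14 : PairExactLocationFarQ 8 14 (9 / 5) 4 := by
  intro u w p R K Q M hw hp hsep hK hQ hfl ha14 hM0 hM10 hu hdisc himp
  have hκ : 0 < ‖K‖ := by
    rcases (norm_nonneg K).lt_or_eq with h | h
    · exact h
    · rw [← h, mul_zero] at hfl; norm_num at hfl
  have hK0 : K ≠ 0 := norm_pos_iff.1 hκ
  have hδ₁n : ‖w - conj w‖ = 2 * w.im := norm_sub_conj_eq w hw
  have hS : w.im + p.im ≤ ‖w - conj p‖ := im_add_im_le_norm_sub_conj w p hw hp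
  have hrS : ‖w - p‖ ≤ ‖w - conj p‖ := norm_sub_le_norm_sub_conj w p hw hp
  obtain ⟨hm0, hmh, hmη⟩ : 0 < min w.im p.im ∧ min w.im p.im ≤ w.im ∧ min w.im p.im ≤ p.im := ⟨lt_min hw hp, min_le_left _ _, min_le_right _ _⟩
  have i2 := mul_le_mul_of_nonneg_right hS hκ.le
  obtain ⟨hL, he⟩ : 8 ≤ w.im * ‖K‖ ∧ 8 ≤ p.im * ‖K‖ :=
    ⟨hfl.trans (mul_le_mul_of_nonneg_right hmh hκ.le), hfl.trans (mul_le_mul_of_nonneg_right hmη hκ.le)⟩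
  have hbL : w.im * ‖K‖ + 8 ≤ ‖w - conj p‖ * ‖K‖ := by linarith
  have hab : ‖w - p‖ * ‖K‖ ≤ ‖w - conj p‖ * ‖K‖ := mul_le_mul_of_nonneg_right hrS hκ.le
  have hr0 : 0 < ‖w - p‖ := pos_of_mul_pos_left (lt_of_lt_of_le (by norm_num) ha14) hκ.le
  -- the displacement `d = u − w`: `‖d‖ ≤ 3/κ ≤ 3·min/8` and `‖d‖κ ≤ 3 < 14 ≤ ‖w − p‖κ`, so every pole stays away
  have hd0 : u - w ≠ 0 := sub_ne_zero.2 hu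
  have hn : 0 < ‖u - w‖ := norm_pos_iff.2 hd0
  have hn38 : ‖u - w‖ ≤ 3 * min w.im p.im / 8 := hdisc.trans (by rw [div_le_div_iff₀ hκ (by norm_num)]; nlinarith)
  have ht3 : ‖u - w‖ * ‖K‖ ≤ 3 := (le_div_iff₀ hκ).1 hdisc
  have hlt2 : ‖u - w‖ < ‖w - p‖ := lt_of_mul_lt_mul_right (by linarith : ‖u - w‖ * ‖K‖ < ‖w - p‖ * ‖K‖) hκ.le
  obtain ⟨hlt1, hlt3⟩ : ‖u - w‖ < ‖w - conj w‖ ∧ ‖u - w‖ < ‖w - conj p‖ := ⟨by rw [hδ₁n]; linarith, by linarith⟩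
  obtain ⟨hne1, hne1'⟩ := ne_zero_of_norm_lt _ _ hlt1
  obtain ⟨hne2, hne2'⟩ := ne_zero_of_norm_lt _ _ hlt2
  obtain ⟨hne3, hne3'⟩ := ne_zero_of_norm_lt _ _ hlt3
  -- rewrite the implicit clause and the goal through `d`, name the objects
  rw [show u - conj w = (w - conj w) + (u - w) by ring, show u - p = (w - p) + (u - w) by ring,
    show u - conj p = (w - conj p) + (u - w) by ring] at himp
  rw [show u - (w - K⁻¹ - Q * K⁻¹ ^ 3) = (u - w) + K⁻¹ + Q * K⁻¹ ^ 3 by ring]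
  set d := u - w; set δ₁ := w - conj w; set δ₂ := w - p; set δ₃ := w - conj p
  set E := d⁻¹ + (δ₁ + d)⁻¹ + (δ₂ + d)⁻¹ + (δ₃ + d)⁻¹ + R with hEdef
  set T := d ^ 2 / (δ₁ ^ 2 * (δ₁ + d)) + d ^ 2 / (δ₂ ^ 2 * (δ₂ + d)) + d ^ 2 / (δ₃ ^ 2 * (δ₃ + d)) with hTdef
  set X := Q * d + T - E with hXdef
  have hKX : K + X = -d⁻¹ := by rw [hXdef, hTdef]; exact K_add_X d δ₁ δ₂ δ₃ R K Q E hne1 hne1' hne2 hne2' hne3 hne3' hK hQ hEdef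
  have herr := norm_key_le d K Q X hd0 hK0 hKX
  have hT : ‖T‖ ≤ ‖d‖ ^ 2 / (‖δ₁‖ ^ 2 * (‖δ₁‖ - ‖d‖)) + ‖d‖ ^ 2 / (‖δ₂‖ ^ 2 * (‖δ₂‖ - ‖d‖))
      + ‖d‖ ^ 2 / (‖δ₃‖ ^ 2 * (‖δ₃‖ - ‖d‖)) := by
    rw [hTdef]
    exact (norm_add_le _ _).trans (add_le_add ((norm_add_le _ _).trans (add_le_add (norm_rem_le δ₁ d hlt1) (norm_rem_le δ₂ d hlt2)))
      (norm_rem_le δ₃ d hlt3))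
  have hQn : ‖Q‖ ≤ 1 / ‖δ₁‖ ^ 2 + 1 / ‖δ₂‖ ^ 2 + 1 / ‖δ₃‖ ^ 2 := by
    rw [hQ, norm_neg]
    refine (norm_add_le _ _).trans (add_le_add ((norm_add_le _ _).trans (add_le_add ?_ ?_)) ?_) <;> rw [norm_pow, norm_inv, inv_pow, one_div]
  have hX1 : ‖X‖ ≤ ‖Q‖ * ‖d‖ + ‖T‖ + ‖E‖ := by
    rw [hXdef]; exact (norm_sub_le _ _).trans (add_le_add ((norm_add_le _ _).trans (by rw [norm_mul])) le_rfl)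
  have hXQ : ‖X - Q * d‖ ≤ ‖T‖ + ‖E‖ := by rw [show X - Q * d = T - E by rw [hXdef]; ring]; exact norm_sub_le _ _
  have hboot1 : ‖K‖ ≤ ‖d‖⁻¹ + ‖X‖ := by
    rw [show K = -d⁻¹ - X by linear_combination hKX]; exact (norm_sub_le _ _).trans (by rw [norm_neg, norm_inv])
  -- scaling identities (`L = Im w·κ`, `a = ‖δ₂‖κ`, `b = ‖δ₃‖κ`, `t = ‖d‖κ`) and the raw kernel
  obtain ⟨hS0, hs1, hs2, hs3⟩ : 0 < ‖δ₃‖ ∧ 0 < 2 * w.im - ‖d‖ ∧ 0 < ‖δ₂‖ - ‖d‖ ∧ 0 < ‖δ₃‖ - ‖d‖ :=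
    ⟨by linarith [norm_nonneg d], by linarith, by linarith, by linarith⟩
  have hκ0 := hκ.ne'; have hw0 := hw.ne'; have hr0' := hr0.ne'; have hS0' := hS0.ne'; have hs1' := hs1.ne'; have hs2' := hs2.ne'; have hs3' := hs3.ne'
  have eQ : 1 / ‖δ₁‖ ^ 2 + 1 / ‖δ₂‖ ^ 2 + 1 / ‖δ₃‖ ^ 2 = ‖K‖ ^ 2 * qh (w.im * ‖K‖) (‖δ₂‖ * ‖K‖) (‖δ₃‖ * ‖K‖) := by
    rw [hδ₁n]; unfold qh; field_simp; ring
  have eT : ‖d‖ ^ 2 / (‖δ₁‖ ^ 2 * (‖δ₁‖ - ‖d‖)) + ‖d‖ ^ 2 / (‖δ₂‖ ^ 2 * (‖δ₂‖ - ‖d‖))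
      + ‖d‖ ^ 2 / (‖δ₃‖ ^ 2 * (‖δ₃‖ - ‖d‖))
      = ‖K‖ * Th (w.im * ‖K‖) (‖δ₂‖ * ‖K‖) (‖δ₃‖ * ‖K‖) (‖d‖ * ‖K‖) := by
    rw [hδ₁n]; unfold Th
    rw [show 2 * (w.im * ‖K‖) - ‖d‖ * ‖K‖ = (2 * w.im - ‖d‖) * ‖K‖ by ring,
      show ‖δ₂‖ * ‖K‖ - ‖d‖ * ‖K‖ = (‖δ₂‖ - ‖d‖) * ‖K‖ by ring,
      show ‖δ₃‖ * ‖K‖ - ‖d‖ * ‖K‖ = (‖δ₃‖ - ‖d‖) * ‖K‖ by ring]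
    field_simp; ring
  have eE : M * ‖d‖ / w.im ^ 2 = ‖K‖ * (M * (‖d‖ * ‖K‖) / (w.im * ‖K‖) ^ 2) := by field_simp
  exact kernel_raw_far (L := w.im * ‖K‖) (a := ‖δ₂‖ * ‖K‖) (b := ‖δ₃‖ * ‖K‖) (t := ‖d‖ * ‖K‖) hκ hw hr0 hn rfl rfl rfl hL ha14 hab hbL hM0 hM10
    ht3 (hT.trans eT.le) (himp.trans eE.le) (hQn.trans eQ.le) hX1 hXQ (norm_nonneg Q) (norm_nonneg X) hboot1 herr
/-- the booked name (DESIGN NOTE 5): `PairExactLocationFarQ 8 14 (9/5) 6`, from `c₂ = 4 ≤ 6`. -/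
theorem pairExactLocationFarTarget_8_14_6 : PairExactLocationFarQ 8 14 (9 / 5) 6 :=
  farQ_mono le_rfl le_rfl le_rfl (by norm_num) pairExactLocationFarQ_8_14
/-- by-name surface: any larger floors / weaker constants. -/
theorem pairExactLocationFarQ_of_le {lam0 a0 c₁ c₂ : ℝ} (h0 : 8 ≤ lam0) (ha : 14 ≤ a0) (h1 : 9 / 5 ≤ c₁) (h2 : 4 ≤ c₂) :
    PairExactLocationFarQ lam0 a0 c₁ c₂ := farQ_mono h0 ha h1 h2 pairExactLocationFarQ_8_14
/-- floor-18 calibration: at the single floor `18` the tree lemma #1248 serves every `a0` (ONE statement shape throughout the (c) table). -/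
theorem pairExactLocationFarQ_18 (a0 : ℝ) : PairExactLocationFarQ 18 a0 (9 / 5) 2 :=
  farQ_of_pairExactLocationQ a0 RhW08.PairExactLocation.pairExactLocationQ_18

end RhW08.PairExactLocationFar
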